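import Summits.CriticalPhenomena.CardyFormulaZ2.Theorems.CardyIKTransportIKLinearTransportQuenchedAssemblyDefs
import Summits.CriticalPhenomena.CardyFormulaZ2.Theorems.CardyIKTransportIKMixedBoxCrossingQuenchedGlueStep
import Summits.CriticalPhenomena.CardyFormulaZ2.Theorems.CardyIKTransportIKLinearTransportFarRSWRingEmpty

/-!
# Stub `stub_ringBlocking` (line `pinned-diagram-exchange` v29, crux `CardyIKTransport.IKLinearTransport`,
# stmt-CriticalPhenomena-5076)

Support file (`--supports stmt-CriticalPhenomena-5076`): the deterministic planar BLOCKING statement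
`RingBlocking` of skeleton v29 (`…IKLinearTransportQuenchedAssemblyDefs`): for every observable configuration
`x = (black cells, anti-diagonal faces)`, every box `[a, a+w) × [b, b+h)` and every `n ≥ 1`, on the frame event
`frameEvent a b w h n` (black left–right crossings of the top strip `[a-n, a+w+n) × [b+h, b+h+n)` and of the bottom
strip `[a-n, a+w+n) × [b-n, b)`, black bottom–top crossings of the left strip `[a-n, a) × [b-n, b+h+n)` and of the
right strip `[a+w, a+w+n) × [b-n, b+h+n)`) every WHITE monochromatic path of the cell triangulation `cellGraph x.2`
meeting the box stays off `farFrom a b w h n` (`ringEvent a b w h n`).  Theorems only (no new vocabulary).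

Proof (pure planar topology of the triangulation with ONE diagonal per face, through the sister crux's landed
tools of `…IKMixedBoxCrossingQuenchedGlueStep`, the bond/site dictionary `pathIn_of_mem_openConnIn` of
`…IKMixedBoxCrossingStubDuality`, and `ring_pathIn_of_chain` of `…IKLinearTransportFarRSWRingEmpty`).
* §1 CROSS-MEET AT EVERY HEIGHT (`meet_all`): a left-to-right path and a bottom-to-top path of the triangulation
  inside the SAME box share a cell — the landed `GlueStep.meet` for height `≥ 2`, and for a box of height `1` (one
  row) the left-to-right path sweeps every column of the row (`GlueStep.pathIn_reach_level`), in particular the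
  column of the first cell of the other path.
* §2 BLOCKING (`stub_ringBlocking`): a white chain from a box cell `u` to a cell of `farFrom a b w h n` is a
  `PathIn`-path inside the white cells (the landed `FarRSWFragments.ring_pathIn_of_chain`), which leaves the
  enlarged box `E = [a-n, a+w+n) × [b-n, b+h+n)` a first time (`PathIn.exit`); since steps move each coordinate by
  at most `1` (`GlueStep.obsGraph_adj_apply_le`), the last cell `z` before the exit lies on one of the four boundary
  layers of `E`.  TOP (`z 1 = b+h+n-1`): the part of the initial piece `u → z` after its last visit to the rows
  `< b+h` (`PathIn.last_exit`) is a white path inside the top strip from row `b+h` to row `b+h+n-1`, which shares a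
  cell with the black left–right crossing of the top strip (`meet_all`) — a cell both black and white.  BOTTOM, LEFT,
  RIGHT likewise (the white piece reversed where `meet_all` wants it oriented upwards / rightwards; on the
  vertical strips the white piece is the left-to-right path and the black crossing the bottom-to-top one).
-/

namespace Summit.CriticalPhenomena.CardyFormulaZ2.Theorems.IKLinearTransport.PinnedDiagramExchange.QuenchedAssembly

open Summit.CriticalPhenomena.CardyFormulaZ2.Theorems.IKLinearTransport.PinnedDiagramExchange
open Summit.CriticalPhenomena.CardyFormulaZ2.Cruxes.IKMixedBoxCrossing.QuenchedChainFKG.GlueStep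
  (meet obsGraph_adj_apply_le pathIn_reach_level)
open Summit.CriticalPhenomena.CardyFormulaZ2.Cruxes.IKMixedBoxCrossing.PairedMirrorExploration.DualityStub
  (pathIn_of_mem_openConnIn)
open Summit.CriticalPhenomena.CardyFormulaZ2.Theorems.IKLinearTransport.PinnedDiagramExchange.FarRSWFragments
  (ring_pathIn_of_chain)
open Literature.Probability.Percolation Literature.Probability.LatticeModels

namespace RingBlockingProof

/-! ## §1 An LR path and a TB path of the same box meet, at every height -/

/-- CROSS-MEET AT EVERY HEIGHT: a left-to-right path `P` (from column `c` to column `c + k`) and a bottom-to-top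
path `Q` (from row `b` to row `b + n`) of the triangulation `cellGraph F`, both inside the box
`[c, c+k] × [b, b+n]`, share a cell.  For `n ≥ 1` this is the landed `GlueStep.meet`; for `n = 0` the box is one
row, which `P` sweeps column by column (`GlueStep.pathIn_reach_level`), visiting the first cell of `Q`. [folklore] -/
theorem meet_all {F T T' : Set (Site 2)} {c b : ℤ} {k n : ℕ} {u v p q : Site 2}
    (hP : PathIn (cellGraph F) T u v)
    (hT : T ⊆ {v : Site 2 | c ≤ v 0 ∧ v 0 < c + (k + 1 : ℕ) ∧ b ≤ v 1 ∧ v 1 < b + (n + 1 : ℕ)})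
    (hu : u 0 = c) (hv : v 0 = c + k) (hQ : PathIn (cellGraph F) T' p q)
    (hT' : T' ⊆ {v : Site 2 | c ≤ v 0 ∧ v 0 < c + (k + 1 : ℕ) ∧ b ≤ v 1 ∧ v 1 < b + (n + 1 : ℕ)})
    (hp : p 1 = b) (hq : q 1 = b + n) : ∃ z, z ∈ T ∧ z ∈ T' := by
  rcases Nat.eq_zero_or_pos n with rfl | hn
  · -- one row: `P` visits the column of the first cell `p` of `Q`, hence `p` itself
    have hpT' := hQ.left_mem
    have hp' := hT' hpT'
    have hv' := hT hP.right_mem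
    simp only [Set.mem_setOf_eq] at hp' hv'
    obtain ⟨w, hw, huw⟩ := pathIn_reach_level hP 0 (k := p 0) (by omega) (by omega)
    have hwT := huw.right_mem
    have hw' := hT hwT
    simp only [Set.mem_setOf_eq] at hw'
    have e : w = p := Contour.site_ext hw (by omega)
    exact ⟨p, e ▸ hwT, hpT'⟩
  · exact meet hn hP hT hu hv hQ hT' hp hq

end RingBlockingProof

/-! ## §2 The registered stub -/

open RingBlockingProof in
/-- **STUB `stub_ringBlocking`** (registered signature): `RingBlocking` — on the frame event (black long-way
crossings of the four `n`-wide strips around the box) every white monochromatic path of the cell triangulation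
meeting the box `[a, a+w) × [b, b+h)` stays off `farFrom a b w h n`.  First exit of the white path from the enlarged
box `[a-n, a+w+n) × [b-n, b+h+n)`, last visit to the box rows / columns before it, and the cross-meet `meet_all` in
the strip of the exit side: the meeting cell would be both black and white. -/
theorem stub_ringBlocking : RingBlocking := by
  intro x a b w h n hn hx
  obtain ⟨m, rfl⟩ : ∃ m, n = m + 1 := ⟨n - 1, by omega⟩
  simp only [frameEvent, Set.mem_inter_iff] at hx
  obtain ⟨⟨hT, hB⟩, hL, hR⟩ := hx
  simp only [ringEvent, Set.mem_setOf_eq]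
  intro p hp hbox v hvp hvF
  obtain ⟨u, hup, hu0, hu1, hu2, hu3⟩ := hbox
  obtain ⟨-, hchain, hwhite⟩ := hp
  -- the white path from the box cell `u` to the far cell `v`
  have hW : ∀ s ∈ p, s ∈ x.1ᶜ := fun s hs hs1 => Bool.false_ne_true ((hwhite s hs).1 hs1)
  have hpath : PathIn (cellGraph x.2) x.1ᶜ u v := ring_pathIn_of_chain hchain hW hup hvp
  simp only [farFrom, Set.mem_setOf_eq] at hvF
  -- its first exit from the enlarged box `E`
  obtain ⟨z, z', hzE, hz'E, -, hzz', hpiece⟩ := hpath.exit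
    (R := {y : Site 2 | a - ((m + 1 : ℕ) : ℤ) ≤ y 0 ∧ y 0 < a + w + ((m + 1 : ℕ) : ℤ) ∧
      b - ((m + 1 : ℕ) : ℤ) ≤ y 1 ∧ y 1 < b + h + ((m + 1 : ℕ) : ℤ)})
    (by simp only [Set.mem_setOf_eq]; omega) (by simp only [Set.mem_setOf_eq]; omega)
  have hzE' : a - ((m + 1 : ℕ) : ℤ) ≤ z 0 ∧ z 0 < a + w + ((m + 1 : ℕ) : ℤ) ∧
      b - ((m + 1 : ℕ) : ℤ) ≤ z 1 ∧ z 1 < b + h + ((m + 1 : ℕ) : ℤ) := hzE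
  have hz'E' : ¬ (a - ((m + 1 : ℕ) : ℤ) ≤ z' 0 ∧ z' 0 < a + w + ((m + 1 : ℕ) : ℤ) ∧
      b - ((m + 1 : ℕ) : ℤ) ≤ z' 1 ∧ z' 1 < b + h + ((m + 1 : ℕ) : ℤ)) := hz'E
  have h4 := obsGraph_adj_apply_le hzz'
  -- the last cell `z` before the exit lies on a boundary layer of `E`
  have hside : z 1 = b + h + m ∨ z 1 = b - (m + 1) ∨ z 0 = a - (m + 1) ∨ z 0 = a + w + m := by omega
  rcases hside with hz1 | hz1 | hz0 | hz0
  · -- TOP: after its last visit below row `b + h`, the piece `u → z` is a white bottom-to-top path of the top strip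
    obtain ⟨c, d, hcC, -, hdC, hcd, hQ⟩ := hpiece.last_exit (C := {y : Site 2 | y 1 < b + h})
      (show u 1 < b + (h : ℤ) from hu3) (show ¬ z 1 < b + (h : ℤ) by omega)
    have hcC' : c 1 < b + h := hcC
    have hdC' : ¬ d 1 < b + h := hdC
    have hd1 : d 1 = b + h := by have := obsGraph_adj_apply_le hcd; omega
    -- the black left-to-right crossing of the top strip
    simp only [lrCross, Set.mem_setOf_eq, mem_openCrossing_iff] at hT
    obtain ⟨s, ⟨hs0, hs1, hs2⟩, t, ⟨ht0, ht1, ht2⟩, hst⟩ := hT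
    have hP := pathIn_of_mem_openConnIn (by rintro rfl; omega) hst
    refine absurd (meet_all (c := a - ((m + 1 : ℕ) : ℤ)) (b := b + (h : ℤ)) (k := w + 2 * m + 1) (n := m)
      hP ?_ hs0 (by omega) hQ ?_ hd1 (by omega)) ?_
    · rintro y ⟨hy, -⟩
      simp only [Set.mem_setOf_eq] at hy ⊢
      omega
    · rintro y ⟨⟨hyE, -⟩, hyC⟩
      simp only [Set.mem_setOf_eq] at hyE hyC ⊢
      omega
    · rintro ⟨y, hyT, hyT'⟩
      exact hyT'.1.2 hyT.2
  · -- BOTTOM: after its last visit to the rows `≥ b`, the piece `u → z`, reversed, is a white bottom-to-top path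
    -- of the bottom strip
    obtain ⟨c, d, hcC, -, hdC, hcd, hQ⟩ := hpiece.last_exit (C := {y : Site 2 | b ≤ y 1})
      (show b ≤ u 1 from hu2) (show ¬ b ≤ z 1 by omega)
    have hcC' : b ≤ c 1 := hcC
    have hdC' : ¬ b ≤ d 1 := hdC
    have hd1 : d 1 = b - 1 := by have := obsGraph_adj_apply_le hcd; omega
    -- the black left-to-right crossing of the bottom strip
    simp only [lrCross, Set.mem_setOf_eq, mem_openCrossing_iff] at hB
    obtain ⟨s, ⟨hs0, hs1, hs2⟩, t, ⟨ht0, ht1, ht2⟩, hst⟩ := hB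
    have hP := pathIn_of_mem_openConnIn (by rintro rfl; omega) hst
    refine absurd (meet_all (c := a - ((m + 1 : ℕ) : ℤ)) (b := b - ((m + 1 : ℕ) : ℤ)) (k := w + 2 * m + 1)
      (n := m) hP ?_ hs0 (by omega) hQ.symm ?_ (by omega) (by omega)) ?_
    · rintro y ⟨hy, -⟩
      simp only [Set.mem_setOf_eq] at hy ⊢
      omega
    · rintro y ⟨⟨hyE, -⟩, hyC⟩
      simp only [Set.mem_setOf_eq] at hyE hyC ⊢
      omega
    · rintro ⟨y, hyT, hyT'⟩
      exact hyT'.1.2 hyT.2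
  · -- LEFT: after its last visit to the columns `≥ a`, the piece `u → z`, reversed, is a white left-to-right path
    -- of the left strip, which meets the black bottom-to-top crossing of the left strip
    obtain ⟨c, d, hcC, -, hdC, hcd, hQ⟩ := hpiece.last_exit (C := {y : Site 2 | a ≤ y 0})
      (show a ≤ u 0 from hu0) (show ¬ a ≤ z 0 by omega)
    have hcC' : a ≤ c 0 := hcC
    have hdC' : ¬ a ≤ d 0 := hdC
    have hd0 : d 0 = a - 1 := by have := obsGraph_adj_apply_le hcd; omega
    -- the black bottom-to-top crossing of the left strip
    simp only [tbCross, Set.mem_setOf_eq, mem_openCrossing_iff] at hL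
    obtain ⟨s, ⟨hs1, hs0, hs0'⟩, t, ⟨ht1, ht0, ht0'⟩, hst⟩ := hL
    have hP := pathIn_of_mem_openConnIn (by rintro rfl; omega) hst
    refine absurd (meet_all (c := a - ((m + 1 : ℕ) : ℤ)) (b := b - ((m + 1 : ℕ) : ℤ)) (k := m)
      (n := h + 2 * m + 1) hQ.symm ?_ (by omega) (by omega) hP ?_ hs1 (by omega)) ?_
    · rintro y ⟨⟨hyE, -⟩, hyC⟩
      simp only [Set.mem_setOf_eq] at hyE hyC ⊢
      omega
    · rintro y ⟨hy, -⟩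
      simp only [Set.mem_setOf_eq] at hy ⊢
      omega
    · rintro ⟨y, hyT, hyT'⟩
      exact hyT.1.2 hyT'.2
  · -- RIGHT: after its last visit to the columns `< a + w`, the piece `u → z` is a white left-to-right path of the
    -- right strip, which meets the black bottom-to-top crossing of the right strip
    obtain ⟨c, d, hcC, -, hdC, hcd, hQ⟩ := hpiece.last_exit (C := {y : Site 2 | y 0 < a + w})
      (show u 0 < a + (w : ℤ) from hu1) (show ¬ z 0 < a + (w : ℤ) by omega)
    have hcC' : c 0 < a + w := hcC
    have hdC' : ¬ d 0 < a + w := hdC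
    have hd0 : d 0 = a + w := by have := obsGraph_adj_apply_le hcd; omega
    -- the black bottom-to-top crossing of the right strip
    simp only [tbCross, Set.mem_setOf_eq, mem_openCrossing_iff] at hR
    obtain ⟨s, ⟨hs1, hs0, hs0'⟩, t, ⟨ht1, ht0, ht0'⟩, hst⟩ := hR
    have hP := pathIn_of_mem_openConnIn (by rintro rfl; omega) hst
    refine absurd (meet_all (c := a + (w : ℤ)) (b := b - ((m + 1 : ℕ) : ℤ)) (k := m) (n := h + 2 * m + 1)
      hQ ?_ hd0 (by omega) hP ?_ hs1 (by omega)) ?_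
    · rintro y ⟨⟨hyE, -⟩, hyC⟩
      simp only [Set.mem_setOf_eq] at hyE hyC ⊢
      omega
    · rintro y ⟨hy, -⟩
      simp only [Set.mem_setOf_eq] at hy ⊢
      omega
    · rintro ⟨y, hyT, hyT'⟩
      exact hyT.1.2 hyT'.2

end Summit.CriticalPhenomena.CardyFormulaZ2.Theorems.IKLinearTransport.PinnedDiagramExchange.QuenchedAssembly
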